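import Mathlib
import Summits.ValiantsHypothesis.ValiantsHypothesis.Theorems.ValuativeGCTValuativeFlipCyclicMembershipS
import Summits.ValiantsHypothesis.ValiantsHypothesis.Theorems.ValuativeGCTValuativeFlipCyclicBottoms
import Summits.ValiantsHypothesis.ValiantsHypothesis.Theorems.ValuativeGCTValuativeFlipFilteredRank

/-!
# Rank of the tangent span of the cyclic tridiagonal pencil (crux `ValuativeGCT.ValuativeFlip`, stub `stub_fourRowPencilRank`)

P4/P5 of the cyclic-tridiagonal architecture for hypothesis `H` of
`fourRowPencilRank_of_pencilCertificate` (`Cruxes/ValuativeFlip/AxisK9G1a2CyclicTridiagonal.md` §4–5).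
For the explicit configuration `l = exL γ`, `m = exM α`, `m' = exM' α` (`α, γ` injective, `2 ≠ 0`):

* the span hypotheses of the membership chains hold (`cyc_hspanT`, `cyc_hspanS`), so every
  multiplied pure product `genR/genL α γ e (q,o,t)` with `e` even, `2 ≤ e ≤ n-3`, lies in the
  tangent span `tanV` (`genR_mem_tanV`, `genL_mem_tanV`);
* grading by the weight `bw`: the weight-`d` component kills the pieces `cycW d'`, `d' > d`, and maps
  `cycW e = span genR e` onto `span srGen` (rank `≥ 2n+2e-2`, file `…StrataRankR`) and
  `cycW (e+1) = span genL e` onto `span slGen` (rank `≥ 4n-2e-4`, file `…StrataRankL`);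
* the filtered rank lemma sums these: **`((n-4)/2)·(6n-6) ≤ finrank tanV`** (`cyc_finrank_tanV_ge`).

[this crux]
-/

set_option linter.dupNamespace false

namespace Summit.ValiantsHypothesis.ValiantsHypothesis.Theorems.ValuativeFlip

open MvPolynomial Module
open scoped BigOperators

noncomputable section

section spanhyp

variable {K : Type*} [Field K] {n : ℕ}

/-- `y_t ∈ linL`. -/
theorem X_mem_linL (t : Fin 4) : (X t : MvPolynomial (Fin 4) K) ∈ linL K :=
  Submodule.subset_span ⟨t, rfl⟩

/-- `y_t - c·y_{t'} ∈ linL`. -/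
theorem X_sub_C_mul_X_mem_linL (t t' : Fin 4) (c : K) :
    (X t - C c * X t' : MvPolynomial (Fin 4) K) ∈ linL K := by
  refine Submodule.sub_mem _ (X_mem_linL t) ?_
  rw [← smul_eq_C_mul]
  exact Submodule.smul_mem _ _ (X_mem_linL t')

/-- The loops of the explicit configuration are linear forms. -/
theorem exL_mem_linL (γ : ZMod n → K) (r : ZMod n) : exL γ r ∈ linL K := X_sub_C_mul_X_mem_linL 2 3 _

/-- The clockwise forms of the explicit configuration are linear forms. -/
theorem exM_mem_linL (α : ZMod n → K) (r : ZMod n) : exM α r ∈ linL K := X_sub_C_mul_X_mem_linL 0 1 _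

/-- The counter-clockwise forms of the explicit configuration are linear forms. -/
theorem exM'_mem_linL (α : ZMod n → K) (r : ZMod n) : exM' α r ∈ linL K := exM_mem_linL α (r + 1)

/-- `srMul t ∈ linL`. -/
theorem srMul_mem_linL (t : Fin 2) : (srMul t : MvPolynomial (Fin 4) K) ∈ linL K := by
  unfold srMul; split_ifs <;> exact X_mem_linL _

/-- `slMul t ∈ linL`. -/
theorem slMul_mem_linL (t : Fin 2) : (slMul t : MvPolynomial (Fin 4) K) ∈ linL K := by
  unfold slMul; split_ifs <;> exact X_mem_linL _

/-- Two forms `y_t - c y_{t'}`, `y_t - d y_{t'}` with `c ≠ d` span `y_t` and `y_{t'}`. -/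
theorem X_pair_mem_span (t t' : Fin 4) {c d : K} (hcd : c ≠ d) :
    (X t : MvPolynomial (Fin 4) K) ∈
        Submodule.span K ({X t - C c * X t', X t - C d * X t'} : Set (MvPolynomial (Fin 4) K)) ∧
      (X t' : MvPolynomial (Fin 4) K) ∈
        Submodule.span K ({X t - C c * X t', X t - C d * X t'} : Set (MvPolynomial (Fin 4) K)) := by
  set S := Submodule.span K ({X t - C c * X t', X t - C d * X t'} : Set (MvPolynomial (Fin 4) K))
  have hu : (X t - C c * X t' : MvPolynomial (Fin 4) K) ∈ S := Submodule.subset_span (by simp)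
  have hv : (X t - C d * X t' : MvPolynomial (Fin 4) K) ∈ S := Submodule.subset_span (by simp)
  have ht' : (X t' : MvPolynomial (Fin 4) K) ∈ S := by
    have h1 : (d - c) • (X t' : MvPolynomial (Fin 4) K) = (X t - C c * X t') - (X t - C d * X t') := by
      rw [smul_eq_C_mul, map_sub]; ring
    have h2 : (X t' : MvPolynomial (Fin 4) K) =
        (d - c)⁻¹ • ((X t - C c * X t') - (X t - C d * X t')) := by
      rw [← h1, inv_smul_smul₀ (sub_ne_zero.mpr hcd.symm)]
    rw [h2]
    exact S.smul_mem _ (S.sub_mem hu hv)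
  refine ⟨?_, ht'⟩
  have h3 : (X t : MvPolynomial (Fin 4) K) = (X t - C c * X t') + c • X t' := by
    rw [smul_eq_C_mul]; ring
  rw [h3]
  exact S.add_mem hu (S.smul_mem _ ht')

/-- Four forms `y₂ - a y₃, y₂ - b y₃, y₀ - c y₁, y₀ - d y₁` with `a ≠ b`, `c ≠ d` span all linear
forms. -/
theorem linL_le_span_four {a b c d : K} (hab : a ≠ b) (hcd : c ≠ d) :
    linL K ≤ Submodule.span K ({X 2 - C a * X 3, X 2 - C b * X 3, X 0 - C c * X 1, X 0 - C d * X 1} :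
      Set (MvPolynomial (Fin 4) K)) := by
  set S := Submodule.span K ({X 2 - C a * X 3, X 2 - C b * X 3, X 0 - C c * X 1, X 0 - C d * X 1} :
      Set (MvPolynomial (Fin 4) K))
  have h23 := X_pair_mem_span (K := K) 2 3 hab
  have h01 := X_pair_mem_span (K := K) 0 1 hcd
  have hS1 : Submodule.span K ({X 2 - C a * X 3, X 2 - C b * X 3} : Set (MvPolynomial (Fin 4) K)) ≤ S := by
    apply Submodule.span_mono
    intro x hx
    simp only [Set.mem_insert_iff, Set.mem_singleton_iff] at hx ⊢
    tauto
  have hS2 : Submodule.span K ({X 0 - C c * X 1, X 0 - C d * X 1} : Set (MvPolynomial (Fin 4) K)) ≤ S := by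
    apply Submodule.span_mono
    intro x hx
    simp only [Set.mem_insert_iff, Set.mem_singleton_iff] at hx ⊢
    tauto
  unfold linL
  rw [Submodule.span_le]
  rintro _ ⟨t, rfl⟩
  fin_cases t
  · exact hS2 h01.1
  · exact hS2 h01.2
  · exact hS1 h23.1
  · exact hS1 h23.2

/-- The span hypothesis of the clockwise chain holds for the explicit configuration. [this crux] -/
theorem cyc_hspanT {α γ : ZMod n → K} (hα : Function.Injective α) (hγ : Function.Injective γ)
    (q : ZMod n) (e : ℕ) (he : 2 ≤ e) (hen : e + 3 ≤ n) :
    linL K ≤ Submodule.span K ({exL γ (q + (e : ZMod n)), exL γ q, exM' α (q + (e : ZMod n)),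
      exM' α (q + 1)} : Set (MvPolynomial (Fin 4) K)) := by
  have hab : γ (q + (e : ZMod n)) ≠ γ q := by
    intro h
    have h1 := hγ h
    have : (e : ZMod n) = 0 := by simpa using h1
    exact natCast_zmod_ne_zero (by omega) (by omega) this
  have hcd : α (q + (e : ZMod n) + 1) ≠ α (q + 1 + 1) := by
    intro h
    have h1 := hα h
    have h2 : (e : ZMod n) = ((1 : ℕ) : ZMod n) := by rw [Nat.cast_one]; linear_combination h1
    have := natCast_zmod_inj (by omega) (by omega) h2
    omega
  exact linL_le_span_four hab hcd

/-- The span hypothesis of the counter-clockwise chain holds for the explicit configuration.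
[this crux] -/
theorem cyc_hspanS {α γ : ZMod n → K} (hα : Function.Injective α) (hγ : Function.Injective γ)
    (q : ZMod n) (e : ℕ) (he : 2 ≤ e) (hen : e + 3 ≤ n) :
    linL K ≤ Submodule.span K ({exL γ q, exL γ (q + (e : ZMod n)), exM α q,
      exM α (q + ((e - 1 : ℕ) : ZMod n))} : Set (MvPolynomial (Fin 4) K)) := by
  have hab : γ q ≠ γ (q + (e : ZMod n)) := by
    intro h
    have h1 := hγ h
    have : (e : ZMod n) = 0 := by linear_combination -h1
    exact natCast_zmod_ne_zero (by omega) (by omega) this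
  have hcd : α q ≠ α (q + ((e - 1 : ℕ) : ZMod n)) := by
    intro h
    have h1 := hα h
    have : ((e - 1 : ℕ) : ZMod n) = 0 := by linear_combination -h1
    exact natCast_zmod_ne_zero (by omega) (by omega) this
  exact linL_le_span_four hab hcd

variable [NeZero n]

/-- Every linear multiple of a selected pure product of even length `2e'+2 ≤ n-3` lies in the tangent
span of the explicit configuration. [this crux] -/
theorem lin_mul_TS_mem_tanV (h2 : (2 : K) ≠ 0) {α γ : ZMod n → K} (hα : Function.Injective α)
    (hγ : Function.Injective γ) (e' : ℕ) (hen : 2 * e' + 2 + 3 ≤ n) (o : Fin 2) (q : ZMod n)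
    {lam : MvPolynomial (Fin 4) K} (hlam : lam ∈ linL K) :
    lam * (if o = 0 then Tw (exL γ) (exM α) (exM' α) q (2 * e' + 2)
      else Sw (exL γ) (exM α) (exM' α) q (2 * e' + 2)) ∈ tanV (exL γ) (exM α) (exM' α) := by
  have hn3 : 3 ≤ n := by omega
  split_ifs
  · exact lin_mul_Tw_mem (exL γ) (exM α) (exM' α) hn3 h2 (exL_mem_linL γ) (exM_mem_linL α)
      (exM'_mem_linL α) (fun q e he hen => cyc_hspanT hα hγ q e he hen) e' hen q lam hlam
  · exact lin_mul_Sw_mem (exL γ) (exM α) (exM' α) hn3 h2 (exL_mem_linL γ) (exM_mem_linL α)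
      (exM'_mem_linL α) (fun q e he hen => cyc_hspanS hα hγ q e he hen) e' hen q lam hlam

end spanhyp

section rank

variable {K : Type*} [Field K] {n : ℕ} (α γ : ZMod n → K)

/-- The graded pieces: `cycW d = span genR d` (`d` even), `span genL (d-1)` (`d` odd). [this crux] -/
def cycW (d : ℕ) : Submodule K (MvPolynomial (Fin 4) K) :=
  if d % 2 = 0 then Submodule.span K (Set.range (genR α γ (2 * (d / 2))))
  else Submodule.span K (Set.range (genL α γ (2 * (d / 2))))

/-- `cycW e = span genR e` for even `e`. -/
theorem cycW_even (e : ℕ) (he : e % 2 = 0) :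
    cycW α γ e = Submodule.span K (Set.range (genR α γ e)) := by
  unfold cycW
  rw [if_pos he, show 2 * (e / 2) = e by omega]

/-- `cycW (e+1) = span genL e` for even `e`. -/
theorem cycW_odd (e : ℕ) (he : e % 2 = 0) :
    cycW α γ (e + 1) = Submodule.span K (Set.range (genL α γ e)) := by
  unfold cycW
  rw [if_neg (by omega), show 2 * ((e + 1) / 2) = e by omega]

/-- The graded pieces are finite-dimensional. -/
theorem cycW_finiteDimensional [NeZero n] (d : ℕ) : FiniteDimensional K (cycW α γ d) := by
  unfold cycW
  by_cases h : d % 2 = 0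
  · rw [if_pos h]; exact FiniteDimensional.span_of_finite K (Set.finite_range _)
  · rw [if_neg h]; exact FiniteDimensional.span_of_finite K (Set.finite_range _)

/-- The weight-`d` component kills the later pieces. [this crux] -/
theorem cycW_le_ker {d d' : ℕ} (h : d < d') :
    cycW α γ d' ≤ LinearMap.ker (weightedHomogeneousComponent bw d) := by
  unfold cycW
  split_ifs with hpar
  · rw [Submodule.span_le]
    rintro _ ⟨i, rfl⟩
    rw [SetLike.mem_coe, LinearMap.mem_ker]
    exact bw_whc_genR_eq_zero α γ (by omega) i
  · rw [Submodule.span_le]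
    rintro _ ⟨i, rfl⟩
    rw [SetLike.mem_coe, LinearMap.mem_ker]
    exact bw_whc_genL_eq_zero α γ (by omega) i

/-- Rank of the bottom of an even piece: `2n + 2e - 2 ≤ finrank (cycW e)_e`. [this crux] -/
theorem finrank_map_cycW_even [NeZero n] {α γ : ZMod n → K} (hα : Function.Injective α)
    (hγ : Function.Injective γ) (e : ℕ) (he : e % 2 = 0) (he1 : 1 ≤ e) (hen : e + 3 ≤ n) :
    2 * n + 2 * e - 2 ≤ finrank K ((cycW α γ e).map (weightedHomogeneousComponent bw e)) := by
  rw [cycW_even α γ e he, Submodule.map_span, ← Set.range_comp]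
  have hc : (weightedHomogeneousComponent bw e) ∘ genR α γ e = srGen α γ e (n - 1 - e) :=
    funext fun i => bw_whc_genR α γ e i
  rw [hc]
  have hb := sr_finrank_span_ge hα hγ (e := e) (k := n - 1 - e) (by omega) he1 (by omega)
  omega

/-- Rank of the bottom of an odd piece: `4n - 2e - 4 ≤ finrank (cycW (e+1))_{e+1}`. [this crux] -/
theorem finrank_map_cycW_odd [NeZero n] {α γ : ZMod n → K} (hα : Function.Injective α)
    (hγ : Function.Injective γ) (e : ℕ) (he : e % 2 = 0) (he2 : 2 ≤ e) (hen : e + 3 ≤ n) :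
    4 * n - 2 * e - 4 ≤
      finrank K ((cycW α γ (e + 1)).map (weightedHomogeneousComponent bw (e + 1))) := by
  rw [cycW_odd α γ e he, Submodule.map_span, ← Set.range_comp]
  have hc : (weightedHomogeneousComponent bw (e + 1)) ∘ genL α γ e = slGen α γ e (n - 1 - e) :=
    funext fun i => bw_whc_genL α γ e i
  rw [hc]
  have hb := sl_finrank_span_ge hα hγ (e := e) (k := n - 1 - e) (by omega) he2 (by omega)
  omega

/-- The pieces lie in the tangent span. [this crux] -/
theorem cycW_le_tanV [NeZero n] (h2 : (2 : K) ≠ 0) {α γ : ZMod n → K} (hα : Function.Injective α)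
    (hγ : Function.Injective γ) (d : ℕ) (hd : 2 ≤ d) (hdn : 2 * (d / 2) + 3 ≤ n) :
    cycW α γ d ≤ tanV (exL γ) (exM α) (exM' α) := by
  obtain ⟨e', he'⟩ : ∃ e', 2 * (d / 2) = 2 * e' + 2 := ⟨d / 2 - 1, by omega⟩
  unfold cycW
  rw [he']
  rw [he'] at hdn
  split_ifs
  · rw [Submodule.span_le]
    rintro _ ⟨i, rfl⟩
    exact lin_mul_TS_mem_tanV h2 hα hγ e' hdn i.2.1 i.1 (srMul_mem_linL i.2.2)
  · rw [Submodule.span_le]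
    rintro _ ⟨i, rfl⟩
    exact lin_mul_TS_mem_tanV h2 hα hγ e' hdn i.2.1 i.1 (slMul_mem_linL i.2.2)

/-- The tangent span is finite-dimensional. -/
theorem tanV_finiteDimensional [NeZero n] (l m m' : ZMod n → MvPolynomial (Fin 4) K) :
    FiniteDimensional K (tanV l m m') := by
  unfold tanV
  exact FiniteDimensional.span_of_finite K (Set.finite_range _)

/-- **Rank of the tangent span of the cyclic tridiagonal pencil** (explicit configuration,
`α, γ` injective, `2 ≠ 0`, `n ≥ 8`): `((n-4)/2)·(6n-6) ≤ finrank tanV`. [this crux] -/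
theorem cyc_finrank_tanV_ge [NeZero n] (h2 : (2 : K) ≠ 0) {α γ : ZMod n → K} (hα : Function.Injective α)
    (hγ : Function.Injective γ) (hn : 8 ≤ n) :
    (n - 4) / 2 * (6 * n - 6) ≤ finrank K (tanV (exL γ) (exM α) (exM' α)) := by
  set s := (n - 4) / 2 with hs
  have hs2 : 2 * s ≤ n - 4 := Nat.mul_div_le (n - 4) 2
  haveI : ∀ d, FiniteDimensional K (cycW α γ d) := fun d => cycW_finiteDimensional α γ d
  haveI := tanV_finiteDimensional (exL γ) (exM α) (exM' α)
  have hsum := fr_sum_finrank_map_le (cycW α γ) (fun d => weightedHomogeneousComponent bw d)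
    (fun d d' h => cycW_le_ker α γ h) (2 * s) 2
  have hY : frY (cycW α γ) 2 (2 * s) ≤ tanV (exL γ) (exM α) (exM' α) :=
    frY_le _ (2 * s) 2 fun d h1 h2' => cycW_le_tanV h2 hα hγ d h1 (by omega)
  have hmono := Submodule.finrank_mono hY
  have hpairs : ∀ s', 2 * s' ≤ n - 4 → s' * (6 * n - 6) ≤
      ∑ i ∈ Finset.range (2 * s'), finrank K ((cycW α γ (2 + i)).map
        (weightedHomogeneousComponent bw (2 + i))) := by
    intro s'
    induction s' with
    | zero => intro; simp
    | succ s' ih =>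
      intro hs'
      rw [show 2 * (s' + 1) = 2 * s' + 1 + 1 by ring, Finset.sum_range_succ, Finset.sum_range_succ,
        show 2 + (2 * s' + 1) = (2 + 2 * s') + 1 by ring]
      have h0 := ih (by omega)
      have hR := finrank_map_cycW_even hα hγ (2 + 2 * s') (by omega) (by omega) (by omega)
      have hL := finrank_map_cycW_odd hα hγ (2 + 2 * s') (by omega) (by omega) (by omega)
      have hmul : (s' + 1) * (6 * n - 6) = s' * (6 * n - 6) + (6 * n - 6) := by ring
      rw [hmul]
      generalize s' * (6 * n - 6) = A at h0 ⊢
      omega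
  exact le_trans (hpairs s hs2) (le_trans hsum hmono)

end rank

end

end Summit.ValiantsHypothesis.ValiantsHypothesis.Theorems.ValuativeFlip
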